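import Mathlib.LinearAlgebra.Matrix.Transvection
import Mathlib.LinearAlgebra.Matrix.Rank
import Mathlib.LinearAlgebra.Matrix.Permutation
import Mathlib.LinearAlgebra.Matrix.GeneralLinearGroup.Defs
import HarnessLib

/-!
# The rank normal form `A = P · E_r · Q` of a square matrix over a field

Topic `LinearAlgebra/Matrix`; namespace `Literature.LinearAlgebra.Matrix`. Pure linear algebra
(Mathlib only): every `n × n` matrix `A` over a field, of rank `r`, is equivalent to the standard
rank-`r` idempotent, `A = P E_r Q` with `P, Q ∈ GL_n` (Gauss; e.g. Bourbaki, *Algèbre* II §10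
no. 12, Prop. 13). Mathlib reduces `A` to a diagonal matrix by transvections
(`Matrix.Pivot.exists_list_transvec_mul_diagonal_mul_list_transvec`); this file finishes the
normalisation (sort the non-zero diagonal entries by a permutation matrix, absorb them into an
invertible diagonal factor):

* `rankStdMatrix n r F = diag(1^r, 0^{n-r})`, `rankStdMatrixLast n r F = diag(0^{n-r}, 1^r)`;
  `rank_rankStdMatrix`; `permMatrix_rev_mul_rankStdMatrix_mul` (they are conjugate by the order
  reversing permutation);
* `permMatrix_mul_diagonal_mul_permMatrix_inv` — `P_σ diag(d) P_{σ⁻¹} = diag(d ∘ σ)`;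
  `exists_perm_apply_ne_zero_iff` — a permutation sorting the non-zero entries to the front;
* `exists_units_eq_mul_rankStdMatrix_mul`, `exists_units_eq_mul_rankStdMatrixLast_mul` — **the rank
  normal forms `A = P E_{rank A} Q`, `A = P E'_{rank A} Q`.**

Used for the orbits of `GL_n(K) × GL_n(K)` on singular matrices (the singular terms of the
Godement–Jacquet functional equation, Godement–Jacquet (1972), §12).
-/

noncomputable section

open Matrix
open scoped Classical

namespace Literature.LinearAlgebra.Matrix

variable {F : Type*} [Field F] {n r : ℕ}

/-- **The standard rank-`r` idempotent `E_r = diag(1, …, 1, 0, …, 0)`** (`r` ones first). [folklore] -/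
def rankStdMatrix (n r : ℕ) (F : Type*) [Zero F] [One F] : Matrix (Fin n) (Fin n) F :=
  diagonal fun i => if (i : ℕ) < r then 1 else 0

/-- Entries of `E_r`. [folklore] -/
theorem rankStdMatrix_apply (r : ℕ) (i j : Fin n) :
    rankStdMatrix n r F i j = if i = j ∧ (i : ℕ) < r then 1 else 0 := by
  unfold rankStdMatrix
  rw [diagonal_apply]
  by_cases hij : i = j
  · simp [hij]
  · simp [hij]

/-- **`rank E_r = r`** for `r ≤ n`. [folklore] -/
theorem rank_rankStdMatrix {r : ℕ} (hr : r ≤ n) : (rankStdMatrix n r F).rank = r := by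
  classical
  unfold rankStdMatrix
  rw [rank_diagonal]
  have h : Fintype.card {i : Fin n // (if (i : ℕ) < r then (1 : F) else 0) ≠ 0} = Fintype.card {i : Fin n // (i : ℕ) < r} :=
    Fintype.card_congr (Equiv.subtypeEquivRight fun i => by
      by_cases hi : (i : ℕ) < r <;> simp [hi])
  rw [h, Fintype.card_fin_lt_of_le hr]

/-- A list of transvections multiplies to an invertible matrix (determinant `1`). [folklore] -/
theorem isUnit_prod_map_toMatrix (L : List (TransvectionStruct (Fin n) F)) :
    IsUnit ((L.map TransvectionStruct.toMatrix).prod : Matrix (Fin n) (Fin n) F) := by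
  rw [isUnit_iff_isUnit_det, TransvectionStruct.det_toMatrix_prod]
  exact isUnit_one

/-- Permutation matrices are invertible. [folklore] -/
theorem isUnit_permMatrix (σ : Equiv.Perm (Fin n)) : IsUnit (σ.permMatrix F) := by
  rw [isUnit_iff_isUnit_det, det_permutation]
  exact (Units.isUnit (Equiv.Perm.sign σ)).map (Int.castRingHom F)

/-- **Conjugating a diagonal matrix by a permutation matrix permutes the diagonal**:
`P_σ · diag(d) · P_{σ⁻¹} = diag(d ∘ σ)`. [folklore] -/
theorem permMatrix_mul_diagonal_mul_permMatrix_inv (σ : Equiv.Perm (Fin n)) (d : Fin n → F) :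
    σ.permMatrix F * diagonal d * (σ⁻¹).permMatrix F = diagonal (d ∘ σ) := by
  unfold Equiv.Perm.permMatrix
  rw [PEquiv.toMatrix_toPEquiv_mul, PEquiv.mul_toMatrix_toPEquiv]
  ext i j
  have hs : (σ⁻¹ : Equiv.Perm (Fin n)).symm j = σ j := by
    rw [Equiv.Perm.inv_def, Equiv.symm_symm]
  simp only [submatrix_apply, id, diagonal_apply, Function.comp_apply, hs, σ.injective.eq_iff]

/-- **A permutation sorting the non-zero entries of `d` to the front**: if exactly `r` of the `d i`
are non-zero, there is `σ` with `d (σ i) ≠ 0 ↔ i < r`. [folklore] -/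
theorem exists_perm_apply_ne_zero_iff (d : Fin n → F) {r : ℕ} (hr : Fintype.card {i : Fin n // d i ≠ 0} = r) :
    ∃ σ : Equiv.Perm (Fin n), ∀ i : Fin n, d (σ i) ≠ 0 ↔ (i : ℕ) < r := by
  classical
  have hrn : r ≤ n := by
    rw [← hr]
    exact (Fintype.card_subtype_le _).trans_eq (Fintype.card_fin n)
  -- equivalences between the two `r`-sets and between their complements
  have hcard₁ : Fintype.card {i : Fin n // (i : ℕ) < r} = Fintype.card {i : Fin n // d i ≠ 0} := by
    rw [Fintype.card_fin_lt_of_le hrn, hr]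
  have hcard₂ : Fintype.card {i : Fin n // ¬ (i : ℕ) < r} = Fintype.card {i : Fin n // ¬ d i ≠ 0} := by
    rw [Fintype.card_subtype_compl, Fintype.card_subtype_compl, hcard₁]
  obtain ⟨e₁⟩ := Fintype.card_eq.1 hcard₁
  obtain ⟨e₂⟩ := Fintype.card_eq.1 hcard₂
  set σ : Equiv.Perm (Fin n) := (Equiv.sumCompl fun i : Fin n => (i : ℕ) < r).symm.trans
    ((e₁.sumCongr e₂).trans (Equiv.sumCompl fun i : Fin n => d i ≠ 0)) with hσ
  refine ⟨σ, fun i => ?_⟩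
  by_cases hi : (i : ℕ) < r
  · have h1 : (Equiv.sumCompl fun i : Fin n => (i : ℕ) < r).symm i = Sum.inl ⟨i, hi⟩ :=
      Equiv.sumCompl_symm_apply_of_pos (p := fun i : Fin n => (i : ℕ) < r) hi
    have : σ i = (e₁ ⟨i, hi⟩ : Fin n) := by
      simp only [hσ, Equiv.trans_apply, h1, Equiv.sumCongr_apply, Sum.map_inl, Equiv.sumCompl_apply_inl]
    rw [this]
    exact ⟨fun _ => hi, fun _ => (e₁ ⟨i, hi⟩).2⟩
  · have h1 : (Equiv.sumCompl fun i : Fin n => (i : ℕ) < r).symm i = Sum.inr ⟨i, hi⟩ :=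
      Equiv.sumCompl_symm_apply_of_neg (p := fun i : Fin n => (i : ℕ) < r) hi
    have : σ i = (e₂ ⟨i, hi⟩ : Fin n) := by
      simp only [hσ, Equiv.trans_apply, h1, Equiv.sumCongr_apply, Sum.map_inr, Equiv.sumCompl_apply_inr]
    rw [this]
    exact ⟨fun h => absurd h (e₂ ⟨i, hi⟩).2, fun h => absurd h hi⟩

/-- **A diagonal matrix with non-zero entries exactly in the first `r` slots is `diag(u) · E_r` with
`u` invertible.** [folklore] -/
theorem diagonal_eq_diagonal_mul_rankStdMatrix {d : Fin n → F} {r : ℕ} (hd : ∀ i : Fin n, d i ≠ 0 ↔ (i : ℕ) < r) :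
    ∃ u : Fin n → F, (∀ i, u i ≠ 0) ∧ diagonal d = diagonal u * rankStdMatrix n r F := by
  classical
  refine ⟨fun i => if (i : ℕ) < r then d i else 1, fun i => ?_, ?_⟩
  · by_cases hi : (i : ℕ) < r
    · simp only [hi, if_true]; exact (hd i).2 hi
    · simp only [hi, if_false]; exact one_ne_zero
  · unfold rankStdMatrix
    rw [diagonal_mul_diagonal]
    congr 1
    funext i
    by_cases hi : (i : ℕ) < r
    · simp [hi]
    · simp only [hi, if_false, mul_zero]
      by_contra h
      exact hi ((hd i).1 h)

/-- An everywhere non-zero diagonal is invertible. [folklore] -/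
theorem isUnit_diagonal_of_ne_zero {u : Fin n → F} (hu : ∀ i, u i ≠ 0) : IsUnit (diagonal u) := by
  rw [isUnit_iff_isUnit_det, det_diagonal]
  exact isUnit_iff_ne_zero.2 (Finset.prod_ne_zero_iff.2 fun i _ => hu i)

/-- **The rank normal form**: every square matrix `A` of rank `r` over a field is `P · E_r · Q` with
`P, Q` invertible (reduction to a diagonal matrix by transvections,
`Matrix.Pivot.exists_list_transvec_mul_diagonal_mul_list_transvec`, a permutation sorting the
non-zero diagonal entries to the front, and an invertible diagonal factor). [folklore] -/
theorem exists_units_eq_mul_rankStdMatrix_mul (A : Matrix (Fin n) (Fin n) F) :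
    ∃ P Q : GL (Fin n) F, A = (P : Matrix (Fin n) (Fin n) F) * rankStdMatrix n A.rank F * (Q : Matrix (Fin n) (Fin n) F) := by
  set r : ℕ := A.rank with hr_def
  obtain ⟨L, L', D, hA⟩ := Pivot.exists_list_transvec_mul_diagonal_mul_list_transvec A
  set T₁ : Matrix (Fin n) (Fin n) F := (L.map TransvectionStruct.toMatrix).prod with hT₁
  set T₂ : Matrix (Fin n) (Fin n) F := (L'.map TransvectionStruct.toMatrix).prod with hT₂
  have hT₁u : IsUnit T₁ := isUnit_prod_map_toMatrix L
  have hT₂u : IsUnit T₂ := isUnit_prod_map_toMatrix L'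
  -- the rank is the number of non-zero diagonal entries
  have hrank : r = Fintype.card {i : Fin n // D i ≠ 0} := by
    rw [hr_def, hA, rank_mul_eq_left_of_isUnit_det _ _ ((isUnit_iff_isUnit_det _).1 hT₂u),
      rank_mul_eq_right_of_isUnit_det _ _ ((isUnit_iff_isUnit_det _).1 hT₁u), rank_diagonal]
  obtain ⟨σ, hσ⟩ := exists_perm_apply_ne_zero_iff D hrank.symm
  obtain ⟨u, hu, hdiag⟩ := diagonal_eq_diagonal_mul_rankStdMatrix hσ
  have hdiag' : diagonal (D ∘ σ) = diagonal u * rankStdMatrix n r F := hdiag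
  -- `diag(D) = P_{σ⁻¹} diag(D ∘ σ) P_σ = P_{σ⁻¹} diag(u) E_r P_σ`
  have h1 : (σ⁻¹).permMatrix F * σ.permMatrix F = 1 := by
    rw [← Matrix.permMatrix_mul, mul_inv_cancel, Matrix.permMatrix_one]
  have hD : diagonal D = (σ⁻¹).permMatrix F * (diagonal u * rankStdMatrix n r F) * σ.permMatrix F := by
    rw [← hdiag', ← permMatrix_mul_diagonal_mul_permMatrix_inv σ D]
    calc diagonal D = ((σ⁻¹).permMatrix F * σ.permMatrix F) * diagonal D * ((σ⁻¹).permMatrix F * σ.permMatrix F) := by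
          rw [h1, one_mul, mul_one]
      _ = (σ⁻¹).permMatrix F * (σ.permMatrix F * diagonal D * (σ⁻¹).permMatrix F) * σ.permMatrix F := by
          simp only [mul_assoc]
  refine ⟨(hT₁u.mul ((isUnit_permMatrix σ⁻¹).mul (isUnit_diagonal_of_ne_zero hu))).unit,
    ((isUnit_permMatrix σ).mul hT₂u).unit, ?_⟩
  rw [IsUnit.unit_spec, IsUnit.unit_spec, hA, hD]
  simp only [mul_assoc]

/-- **The standard rank-`r` idempotent with the ones last**: `E'_r = diag(0, …, 0, 1, …, 1)`
(`r` ones in the last `r` slots). [folklore] -/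
def rankStdMatrixLast (n r : ℕ) (F : Type*) [Zero F] [One F] : Matrix (Fin n) (Fin n) F :=
  diagonal fun i => if (i : ℕ) < n - r then 0 else 1

/-- Entries of `E'_r`. [folklore] -/
theorem rankStdMatrixLast_apply (r : ℕ) (i j : Fin n) :
    rankStdMatrixLast n r F i j = if i = j ∧ ¬ (i : ℕ) < n - r then 1 else 0 := by
  unfold rankStdMatrixLast
  rw [diagonal_apply]
  by_cases hij : i = j
  · subst hij
    by_cases hi : (i : ℕ) < n - r
    · simp [hi]
    · simp [hi]
  · simp [hij]

/-- **`E'_r` is the conjugate of `E_r` by the order-reversing permutation** (`r ≤ n`). [folklore] -/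
theorem permMatrix_rev_mul_rankStdMatrix_mul (hr : r ≤ n) :
    (Fin.revPerm : Equiv.Perm (Fin n)).permMatrix F * rankStdMatrix n r F * (Fin.revPerm⁻¹ : Equiv.Perm (Fin n)).permMatrix F =
      rankStdMatrixLast n r F := by
  unfold rankStdMatrix rankStdMatrixLast
  rw [permMatrix_mul_diagonal_mul_permMatrix_inv]
  congr 1
  funext i
  simp only [Function.comp_apply, Fin.revPerm_apply, Fin.val_rev]
  by_cases hi : (i : ℕ) < n - r
  · rw [if_neg (by omega), if_pos hi]
  · rw [if_pos (by omega), if_neg hi]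

/-- **The rank normal form with the ones last**: `A = P · E'_{rank A} · Q` with `P, Q` invertible.
[folklore] -/
theorem exists_units_eq_mul_rankStdMatrixLast_mul (A : Matrix (Fin n) (Fin n) F) :
    ∃ P Q : GL (Fin n) F, A = (P : Matrix (Fin n) (Fin n) F) * rankStdMatrixLast n A.rank F * (Q : Matrix (Fin n) (Fin n) F) := by
  set r : ℕ := A.rank with hr_def
  obtain ⟨P, Q, hA⟩ := exists_units_eq_mul_rankStdMatrix_mul A
  rw [← hr_def] at hA
  have hr : r ≤ n := (rank_le_card_width A).trans_eq (Fintype.card_fin n)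
  set w : Equiv.Perm (Fin n) := Fin.revPerm with hw
  have h1 : (w⁻¹).permMatrix F * w.permMatrix F = 1 := by
    rw [← Matrix.permMatrix_mul, mul_inv_cancel, Matrix.permMatrix_one]
  have hE : rankStdMatrix n r F = (w⁻¹).permMatrix F * rankStdMatrixLast n r F * w.permMatrix F := by
    rw [← permMatrix_rev_mul_rankStdMatrix_mul hr, ← hw]
    calc rankStdMatrix n r F = ((w⁻¹).permMatrix F * w.permMatrix F) * rankStdMatrix n r F *
          ((w⁻¹).permMatrix F * w.permMatrix F) := by rw [h1, one_mul, mul_one]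
      _ = (w⁻¹).permMatrix F * (w.permMatrix F * rankStdMatrix n r F * (w⁻¹).permMatrix F) * w.permMatrix F := by
          simp only [mul_assoc]
  refine ⟨P * (isUnit_permMatrix w⁻¹).unit, (isUnit_permMatrix w).unit * Q, ?_⟩
  rw [Units.val_mul, Units.val_mul, IsUnit.unit_spec, IsUnit.unit_spec, hA, hE]
  simp only [mul_assoc]

end Literature.LinearAlgebra.Matrix
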